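import Mathlib
import Summits.MatrixMultiplication.MatrixMultiplication.Theorems.FidelityWitnessesDiagonalPowerDecayStubNonnegFlatDecayObjects

/-!
# Tightness of `stub_nonnegFlatDecay` (line `unit-tensor-orbit-nuclear-ratio`, crux `FidelityWitnesses.DiagonalPowerDecay`,
# stmt-MatrixMultiplication-14053): every witness has `δ ≤ 3/2 − log 6/log 4 ≈ 0.2075`

Lead prover-line-stmt-MatrixMultiplication-14053-1.  The registered open stub says: some `c`, `δ > 0` have, for every
finite format `ι` (`N = |ι|`), every entrywise non-negative flat `Y` and every open-orbit point `S = (A,B,C)·I_ι`,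
`|⟨S,Y⟩|² ≤ c·N^{3/2−δ}·‖S‖²`.  THIS FILE: `nonnegFlatDecay_delta_le` (registered sub-goal, def-free; internally
`delta_le_of_body`): every witness has `δ ≤ 3/2 − logb 4 6`; rational form `δ < 21/100` (`nonnegFlatDecay_delta_lt`,
from `4¹²⁹ < 6¹⁰⁰`).  Also the registered sub-goal `flat_kron_nonneg` (the non-negative half of Zhu–Chen–Hayashi 2010,
arXiv:1002.2511: `Y₁ ≥ 0` flat and `Y₂` flat ⟹ `Y₁ ⊠ Y₂` flat; `flat_kron`).

Proof (objects in `…StubNonnegFlatDecayObjects.lean`).  Strassen's tensor `str` is `0/1`, FLAT (`flat_str`: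
`|x₀⟨y',z'⟩ + y₀⟨x',z'⟩| ≤ ‖x‖‖y‖‖z‖` by two Cauchy–Schwarz steps), `‖str‖² = 6`, and `str + t·I₄` is an open-orbit point
for `t ≠ 0`.  Its Kronecker powers on `Fin j → Fin 4` (`|ι| = 4^j`) are `0/1`, flat (`flat_kpow` via `flat_kron` and
`flat_reindex`), of norm² `6^j` (`normSq_kpow`), and limits (`t → 0`) of the orbit points `(matA t, matA t, matC t)^{⊗j}·I`;
the stub on those points passes to the limit and reads `(6^j)² ≤ c·(4^j)^{3/2−δ}·6^j`, so `6^j ≤ c·(4^{3/2−δ})^j` for all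
`j`, whence `6 ≤ 4^{3/2−δ}` (`le_of_pow_le_mul_pow`) and `logb 4 6 ≤ 3/2 − δ`.

Meaning.  The `T`-free non-negative flat class of the stub provably out-captures every KNOWN matrix-multiplication point:
exponent `log 6/log 4 = 1.2925 > 3/ω` for every proved `ω` (`3/2.3714 = 1.2651`); for the crux itself the certified cap is
`δ < 41/106 ≈ 0.387` (Cruxes/…/Disproof.lean `CertN4`).  Not a kill of the stub (that needs exponent `3/2`), but a
kernel-checked lower bound on its extra exposure beyond the crux.
-/

-- the tree's namespace `Summit.MatrixMultiplication.MatrixMultiplication.…` repeats a component by design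
set_option linter.dupNamespace false

noncomputable section

namespace Summit.MatrixMultiplication.MatrixMultiplication.Theorems.DiagonalPowerDecay

namespace NonnegFlatTightness

open scoped BigOperators
open Filter Topology

/-! ## Sums over product formats and reindexing -/

section Sums

variable {α β γ : Type} [Fintype α] [Fintype β] [Fintype γ]

/-- Regrouping a triple sum over a product type. -/
theorem sum3_prod {M : Type*} [AddCommMonoid M] (F : α × β → α × β → α × β → M) :
    (∑ x : α × β, ∑ y : α × β, ∑ z : α × β, F x y z) =
      ∑ a, ∑ b, ∑ c, ∑ a', ∑ b', ∑ c', F (a, a') (b, b') (c, c') := by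
  simp only [Fintype.sum_prod_type]
  refine Finset.sum_congr rfl fun a _ => ?_
  -- `∑ a', ∑ b, ∑ b', ∑ c, ∑ c' = ∑ b, ∑ c, ∑ a', ∑ b', ∑ c'`
  rw [Finset.sum_comm]
  refine Finset.sum_congr rfl fun b _ => ?_
  calc (∑ a', ∑ b', ∑ c, ∑ c', F (a, a') (b, b') (c, c'))
      = ∑ a', ∑ c, ∑ b', ∑ c', F (a, a') (b, b') (c, c') :=
        Finset.sum_congr rfl fun a' _ => Finset.sum_comm
    _ = ∑ c, ∑ a', ∑ b', ∑ c', F (a, a') (b, b') (c, c') := Finset.sum_comm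

/-- Reindexing a triple sum along an equivalence. -/
theorem sum_reindex3 {M : Type*} [AddCommMonoid M] (e : γ ≃ α) (F : α → α → α → M) :
    (∑ x : γ, ∑ y : γ, ∑ z : γ, F (e x) (e y) (e z)) = ∑ a, ∑ b, ∑ c, F a b c := by
  refine Fintype.sum_equiv e _ _ fun x => ?_
  refine Fintype.sum_equiv e _ _ fun y => ?_
  exact Fintype.sum_equiv e _ _ fun z => rfl

end Sums

section Flatness

variable {α β γ : Type} [Fintype α] [Fintype β] [Fintype γ]

/-- Flatness is invariant under reindexing the format along an equivalence. -/
theorem flat_reindex (e : γ ≃ α) {Y : α → α → α → ℂ} (h : Flat Y) :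
    Flat (fun x y z : γ => Y (e x) (e y) (e z)) := by
  intro w u v
  have key := h (fun a => w (e.symm a)) (fun b => u (e.symm b)) (fun c => v (e.symm c))
  have hL : (∑ x, ∑ y, ∑ z, w x * u y * v z * Y (e x) (e y) (e z)) =
      ∑ a, ∑ b, ∑ c, w (e.symm a) * u (e.symm b) * v (e.symm c) * Y a b c := by
    rw [← sum_reindex3 e (fun a b c => w (e.symm a) * u (e.symm b) * v (e.symm c) * Y a b c)]
    simp
  have hR : ∀ f : γ → ℂ, (∑ a, ‖f (e.symm a)‖ ^ 2) = ∑ x, ‖f x‖ ^ 2 := fun f =>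
    Equiv.sum_comp e.symm (fun x => ‖f x‖ ^ 2)
  rw [hL, ← hR w, ← hR u, ← hR v]
  exact key

/-- **The non-negative half of Zhu–Chen–Hayashi (2010): `Y₁ ≥ 0` flat and `Y₂` flat ⟹ `Y₁ ⊠ Y₂` flat.**
`|Σ w u v (Y₁⊠Y₂)| = |Σ_{abc} Y₁(abc)·⟨fibres, Y₂⟩| ≤ Σ_{abc} Y₁(abc)·‖w_a‖‖u_b‖‖v_c‖ ≤ ‖w‖‖u‖‖v‖`. -/
theorem flat_kron {Y₁ : α → α → α → ℂ} {Y₂ : β → β → β → ℂ}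
    (h₁ : ∀ a b c, ∃ t : ℝ, 0 ≤ t ∧ Y₁ a b c = t) (hf₁ : Flat Y₁) (hf₂ : Flat Y₂) :
    Flat (fun x y z : α × β => Y₁ x.1 y.1 z.1 * Y₂ x.2 y.2 z.2) := by
  intro w u v
  choose t ht0 hYt using h₁
  -- fibre norms
  let W : α → ℝ := fun a => Real.sqrt (∑ a', ‖w (a, a')‖ ^ 2)
  let U : α → ℝ := fun b => Real.sqrt (∑ b', ‖u (b, b')‖ ^ 2)
  let V : α → ℝ := fun c => Real.sqrt (∑ c', ‖v (c, c')‖ ^ 2)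
  have hW0 : ∀ a, 0 ≤ W a := fun a => Real.sqrt_nonneg _
  have hU0 : ∀ b, 0 ≤ U b := fun b => Real.sqrt_nonneg _
  have hV0 : ∀ c, 0 ≤ V c := fun c => Real.sqrt_nonneg _
  -- the inner overlaps with `Y₂` on the fibres
  let inner : α → α → α → ℂ := fun a b c =>
    ∑ a', ∑ b', ∑ c', w (a, a') * u (b, b') * v (c, c') * Y₂ a' b' c'
  -- Step 1: regroup the sum
  have hre : (∑ x, ∑ y, ∑ z, w x * u y * v z * (Y₁ x.1 y.1 z.1 * Y₂ x.2 y.2 z.2)) =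
      ∑ a, ∑ b, ∑ c, Y₁ a b c * inner a b c := by
    rw [sum3_prod]
    refine Finset.sum_congr rfl fun a _ => Finset.sum_congr rfl fun b _ =>
      Finset.sum_congr rfl fun c _ => ?_
    simp only [inner, Finset.mul_sum]
    refine Finset.sum_congr rfl fun a' _ => Finset.sum_congr rfl fun b' _ =>
      Finset.sum_congr rfl fun c' _ => ?_
    ring
  -- Step 2: flatness of `Y₂` on the fibres
  have hin : ∀ a b c, ‖inner a b c‖ ≤ W a * U b * V c := fun a b c =>
    hf₂ (fun a' => w (a, a')) (fun b' => u (b, b')) (fun c' => v (c, c'))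
  -- Step 3: triangle inequality with the non-negative weights `Y₁ = t`
  have h3 : ‖∑ a, ∑ b, ∑ c, Y₁ a b c * inner a b c‖ ≤ ∑ a, ∑ b, ∑ c, t a b c * (W a * U b * V c) := by
    refine (norm_sum_le _ _).trans (Finset.sum_le_sum fun a _ => (norm_sum_le _ _).trans
      (Finset.sum_le_sum fun b _ => (norm_sum_le _ _).trans (Finset.sum_le_sum fun c _ => ?_)))
    rw [norm_mul, hYt, Complex.norm_real, Real.norm_of_nonneg (ht0 a b c)]
    exact mul_le_mul_of_nonneg_left (hin a b c) (ht0 a b c)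
  -- Step 4: flatness of `Y₁` on the real vectors `(W, U, V)`
  have h4 := hf₁ (fun a => (W a : ℂ)) (fun b => (U b : ℂ)) (fun c => (V c : ℂ))
  have h4' : (∑ a, ∑ b, ∑ c, (W a : ℂ) * (U b : ℂ) * (V c : ℂ) * Y₁ a b c) =
      ((∑ a, ∑ b, ∑ c, t a b c * (W a * U b * V c) : ℝ) : ℂ) := by
    push_cast
    refine Finset.sum_congr rfl fun a _ => Finset.sum_congr rfl fun b _ =>
      Finset.sum_congr rfl fun c _ => ?_
    rw [hYt]; ring
  have hpos : 0 ≤ ∑ a, ∑ b, ∑ c, t a b c * (W a * U b * V c) :=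
    Finset.sum_nonneg fun a _ => Finset.sum_nonneg fun b _ => Finset.sum_nonneg fun c _ =>
      mul_nonneg (ht0 a b c) (mul_nonneg (mul_nonneg (hW0 a) (hU0 b)) (hV0 c))
  rw [h4', Complex.norm_real, Real.norm_of_nonneg hpos] at h4
  -- the norms of the real vectors are the norms of `w, u, v`
  have hsq : ∀ (f : α × β → ℂ) (a : α),
      ‖((Real.sqrt (∑ a', ‖f (a, a')‖ ^ 2) : ℝ) : ℂ)‖ ^ 2 = ∑ a', ‖f (a, a')‖ ^ 2 := by
    intro f a
    rw [Complex.norm_real, Real.norm_of_nonneg (Real.sqrt_nonneg _), Real.sq_sqrt (by positivity)]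
  have hWs : (∑ a, ‖(W a : ℂ)‖ ^ 2) = ∑ x : α × β, ‖w x‖ ^ 2 := by
    rw [Fintype.sum_prod_type]; exact Finset.sum_congr rfl fun a _ => hsq w a
  have hUs : (∑ b, ‖(U b : ℂ)‖ ^ 2) = ∑ y : α × β, ‖u y‖ ^ 2 := by
    rw [Fintype.sum_prod_type]; exact Finset.sum_congr rfl fun b _ => hsq u b
  have hVs : (∑ c, ‖(V c : ℂ)‖ ^ 2) = ∑ z : α × β, ‖v z‖ ^ 2 := by
    rw [Fintype.sum_prod_type]; exact Finset.sum_congr rfl fun c _ => hsq v c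
  rw [hWs, hUs, hVs] at h4
  calc ‖∑ x, ∑ y, ∑ z, w x * u y * v z * (Y₁ x.1 y.1 z.1 * Y₂ x.2 y.2 z.2)‖
      = ‖∑ a, ∑ b, ∑ c, Y₁ a b c * inner a b c‖ := by rw [hre]
    _ ≤ ∑ a, ∑ b, ∑ c, t a b c * (W a * U b * V c) := h3
    _ ≤ _ := h4

/-- Complex Cauchy–Schwarz for three terms: `‖Σ_{k<3} f k·g k‖ ≤ √(Σ‖f k‖²)·√(Σ‖g k‖²)`. -/
theorem norm_sum_mul_le_three (f g : Fin 3 → ℂ) :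
    ‖∑ k, f k * g k‖ ≤ Real.sqrt (∑ k, ‖f k‖ ^ 2) * Real.sqrt (∑ k, ‖g k‖ ^ 2) := by
  calc ‖∑ k, f k * g k‖ ≤ ∑ k, ‖f k‖ * ‖g k‖ :=
        (norm_sum_le _ _).trans (le_of_eq (Finset.sum_congr rfl fun k _ => norm_mul _ _))
    _ ≤ _ := Real.sum_mul_le_sqrt_mul_sqrt _ _ _

/-- **Strassen's tensor is flat**: `|x₀⟨y',z'⟩ + y₀⟨x',z'⟩| ≤ ‖x‖‖y‖‖z‖`. -/
theorem flat_str : Flat str := by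
  intro w u v
  -- the trilinear form, explicitly
  have hsum : (∑ i, ∑ j, ∑ k, w i * u j * v k * str i j k) =
      w 0 * (∑ k : Fin 3, u k.succ * v k.succ) + u 0 * (∑ k : Fin 3, w k.succ * v k.succ) := by
    simp [Fin.sum_univ_four, Fin.sum_univ_three, str]
    ring
  rw [hsum]
  -- tail norms
  set nw := Real.sqrt (∑ k : Fin 3, ‖w k.succ‖ ^ 2) with hnw
  set nu := Real.sqrt (∑ k : Fin 3, ‖u k.succ‖ ^ 2) with hnu
  set nv := Real.sqrt (∑ k : Fin 3, ‖v k.succ‖ ^ 2) with hnv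
  have h1 : ‖∑ k : Fin 3, u k.succ * v k.succ‖ ≤ nu * nv := norm_sum_mul_le_three _ _
  have h2 : ‖∑ k : Fin 3, w k.succ * v k.succ‖ ≤ nw * nv := norm_sum_mul_le_three _ _
  have hnv0 : 0 ≤ nv := Real.sqrt_nonneg _
  have hnu0 : 0 ≤ nu := Real.sqrt_nonneg _
  have hnw0 : 0 ≤ nw := Real.sqrt_nonneg _
  -- full norms
  have hwfull : Real.sqrt (∑ i, ‖w i‖ ^ 2) = Real.sqrt (‖w 0‖ ^ 2 + nw ^ 2) := by
    rw [hnw, Real.sq_sqrt (by positivity), Fin.sum_univ_succ]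
  have hufull : Real.sqrt (∑ j, ‖u j‖ ^ 2) = Real.sqrt (nu ^ 2 + ‖u 0‖ ^ 2) := by
    rw [hnu, Real.sq_sqrt (by positivity), Fin.sum_univ_succ, add_comm]
  have hvfull : nv ≤ Real.sqrt (∑ k, ‖v k‖ ^ 2) := by
    rw [hnv, Fin.sum_univ_succ (f := fun k => ‖v k‖ ^ 2)]
    exact Real.sqrt_le_sqrt (by nlinarith [sq_nonneg ‖v 0‖])
  calc ‖w 0 * ∑ k : Fin 3, u k.succ * v k.succ + u 0 * ∑ k : Fin 3, w k.succ * v k.succ‖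
      ≤ ‖w 0‖ * (nu * nv) + ‖u 0‖ * (nw * nv) := by
        refine (norm_add_le _ _).trans (add_le_add ?_ ?_)
        · rw [norm_mul]; exact mul_le_mul_of_nonneg_left h1 (norm_nonneg _)
        · rw [norm_mul]; exact mul_le_mul_of_nonneg_left h2 (norm_nonneg _)
    _ = (‖w 0‖ * nu + nw * ‖u 0‖) * nv := by ring
    _ ≤ (Real.sqrt (‖w 0‖ ^ 2 + nw ^ 2) * Real.sqrt (nu ^ 2 + ‖u 0‖ ^ 2)) * nv := by
        -- Cauchy–Schwarz in `ℝ²`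
        refine mul_le_mul_of_nonneg_right ?_ hnv0
        rw [← Real.sqrt_mul (by positivity)]
        refine Real.le_sqrt_of_sq_le ?_
        nlinarith [sq_nonneg (‖w 0‖ * ‖u 0‖ - nw * nu)]
    _ ≤ (Real.sqrt (‖w 0‖ ^ 2 + nw ^ 2) * Real.sqrt (nu ^ 2 + ‖u 0‖ ^ 2)) *
          Real.sqrt (∑ k, ‖v k‖ ^ 2) :=
        mul_le_mul_of_nonneg_left hvfull (mul_nonneg (Real.sqrt_nonneg _) (Real.sqrt_nonneg _))
    _ = _ := by rw [hwfull, hufull]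

/-- The empty Kronecker power (the constant tensor `1` on the one-point format `Fin 0 → Fin 4`) is flat. -/
theorem flat_kpow_zero (T : Fin 4 → Fin 4 → Fin 4 → ℂ) : Flat (kpow T 0) := by
  intro w u v
  simp only [kpow, Finset.univ_eq_empty, Finset.prod_empty, mul_one,
    Finset.univ_unique, Finset.sum_singleton]
  rw [Real.sqrt_sq (norm_nonneg _), Real.sqrt_sq (norm_nonneg _), Real.sqrt_sq (norm_nonneg _),
    norm_mul, norm_mul]

/-- Kronecker powers of a `0/1` flat tensor are flat. -/
theorem flat_kpow {T : Fin 4 → Fin 4 → Fin 4 → ℂ} (h01 : ZeroOne T) (hT : Flat T) : ∀ j, Flat (kpow T j) := by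
  intro j
  induction j with
  | zero => exact flat_kpow_zero T
  | succ j ih =>
    have hk := flat_kron (nonneg_of_zeroOne h01) hT ih
    have hr := flat_reindex (Fin.consEquiv (fun _ : Fin (j + 1) => Fin 4)).symm hk
    have heq : kpow T (j + 1) = fun a b c : Fin (j + 1) → Fin 4 =>
        (fun x y z : Fin 4 × (Fin j → Fin 4) => T x.1 y.1 z.1 * kpow T j x.2 y.2 z.2)
          ((Fin.consEquiv (fun _ : Fin (j + 1) => Fin 4)).symm a)
          ((Fin.consEquiv (fun _ : Fin (j + 1) => Fin 4)).symm b)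
          ((Fin.consEquiv (fun _ : Fin (j + 1) => Fin 4)).symm c) := by
      funext a b c
      rw [kpow_succ]
      simp [Fin.consEquiv]
    rw [heq]
    exact hr

end Flatness

/-! ## Norms of Kronecker powers -/

/-- `‖T^{⊠j}‖² = (‖T‖²)^j`. -/
theorem normSq_kpow (T : Fin 4 → Fin 4 → Fin 4 → ℂ) (j : ℕ) :
    (∑ a, ∑ b, ∑ c, ‖kpow T j a b c‖ ^ 2) = (∑ i, ∑ i', ∑ k, ‖T i i' k‖ ^ 2) ^ j := by
  induction j with
  | zero =>
    simp [kpow, Finset.univ_unique]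
  | succ j ih =>
    have heq : ∀ a b c : Fin (j + 1) → Fin 4, ‖kpow T (j + 1) a b c‖ ^ 2 =
        (fun x y z : Fin 4 × (Fin j → Fin 4) => ‖T x.1 y.1 z.1‖ ^ 2 * ‖kpow T j x.2 y.2 z.2‖ ^ 2)
          ((Fin.consEquiv (fun _ : Fin (j + 1) => Fin 4)).symm a)
          ((Fin.consEquiv (fun _ : Fin (j + 1) => Fin 4)).symm b)
          ((Fin.consEquiv (fun _ : Fin (j + 1) => Fin 4)).symm c) := by
      intro a b c
      rw [kpow_succ, norm_mul, mul_pow]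
      simp [Fin.consEquiv]
    simp only [heq]
    rw [sum_reindex3 (Fin.consEquiv (fun _ : Fin (j + 1) => Fin 4)).symm
      (fun x y z : Fin 4 × (Fin j → Fin 4) => ‖T x.1 y.1 z.1‖ ^ 2 * ‖kpow T j x.2 y.2 z.2‖ ^ 2)]
    rw [sum3_prod, pow_succ, ← ih]
    simp only [Finset.mul_sum, Finset.sum_mul]
    refine Finset.sum_congr rfl fun a _ => Finset.sum_congr rfl fun b _ =>
      Finset.sum_congr rfl fun c _ => Finset.sum_congr rfl fun a' _ =>
      Finset.sum_congr rfl fun b' _ => Finset.sum_congr rfl fun c' _ => ?_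
    ring

/-- For a `0/1` tensor the self-overlap is the squared norm: `Σ Y·Y = Σ ‖Y‖²`. -/
theorem overlap_self_of_zeroOne {ι : Type} [Fintype ι] {Y : ι → ι → ι → ℂ} (h : ZeroOne Y) :
    (∑ a, ∑ b, ∑ c, Y a b c * Y a b c) = ((∑ a, ∑ b, ∑ c, ‖Y a b c‖ ^ 2 : ℝ) : ℂ) := by
  push_cast
  refine Finset.sum_congr rfl fun a _ => Finset.sum_congr rfl fun b _ =>
    Finset.sum_congr rfl fun c _ => ?_
  rcases h a b c with h0 | h1
  · simp [h0]
  · simp [h1]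

/-! ## Elementary real analysis -/

/-- If `x^j ≤ C·y^j` for all `j` (`y > 0`), then `x ≤ y`. -/
theorem le_of_pow_le_mul_pow {x y C : ℝ} (hy : 0 < y) (h : ∀ j : ℕ, x ^ j ≤ C * y ^ j) : x ≤ y := by
  by_contra hxy
  push Not at hxy
  have hx : 0 < x := hy.trans hxy
  have hr : 1 < x / y := (one_lt_div hy).mpr hxy
  have hb : ∀ j : ℕ, (x / y) ^ j ≤ C := fun j => by
    rw [div_pow, div_le_iff₀ (pow_pos hy j)]
    exact h j
  obtain ⟨j, hj⟩ := (tendsto_pow_atTop_atTop_of_one_lt hr).eventually_gt_atTop C |>.exists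
  exact absurd (hb j) (not_le.mpr hj)

/-- `(x^j)^s = (x^s)^j` for `x ≥ 0`. -/
theorem rpow_natPow_comm {x : ℝ} (hx : 0 ≤ x) (s : ℝ) (j : ℕ) : (x ^ j) ^ s = (x ^ s) ^ j := by
  rw [← Real.rpow_natCast x j, ← Real.rpow_mul hx, mul_comm, Real.rpow_mul hx, Real.rpow_natCast]

/-! ## The δ-cap -/

/-- **Every witness `(c, δ)` of `stub_nonnegFlatDecay` has `δ ≤ 3/2 − log 6/log 4 ≈ 0.2075`** (Strassen's tensor and
its Kronecker powers; `T`-free). -/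
theorem delta_le_of_body {c δ : ℝ} (h : NonnegFlatDecayBody c δ) : δ ≤ 3 / 2 - Real.logb 4 6 := by
  -- Step 1: for every `j`, `6^j ≤ c · (4^{3/2-δ})^j`
  have key : ∀ j : ℕ, (6 : ℝ) ^ j ≤ c * ((4 : ℝ) ^ ((3 : ℝ) / 2 - δ)) ^ j := by
    intro j
    have hY01 : ZeroOne (kpow str j) := zeroOne_kpow zeroOne_str j
    have hYflat : Flat (kpow str j) := flat_kpow zeroOne_str flat_str j
    have hnormSq : (∑ a, ∑ b, ∑ c', ‖kpow str j a b c'‖ ^ 2) = 6 ^ j := by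
      rw [normSq_kpow, normSq_str]
    -- the stub on the orbit points `(Str + t I)^{⊠j}`, `t ≠ 0`
    have horb : ∀ t : ℝ, t ≠ 0 →
        ‖∑ a, ∑ b, ∑ c', kpow (strT t) j a b c' * kpow str j a b c'‖ ^ 2 ≤
          c * ((4 : ℝ) ^ j) ^ ((3 : ℝ) / 2 - δ) * ∑ a, ∑ b, ∑ c', ‖kpow (strT t) j a b c'‖ ^ 2 := by
      intro t ht
      have hb := h (Fin j → Fin 4) (kpow str j) (nonneg_of_zeroOne hY01) hYflat
        (mpow (matA t) j) (mpow (matA t) j) (mpow (matC t) j)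
        (isUnit_det_mpow (matA_mul_matAinv ht) j) (isUnit_det_mpow (matA_mul_matAinv ht) j)
        (isUnit_det_mpow (matC_mul_matCinv ht) j)
      have horbit : ∀ a b c' : Fin j → Fin 4,
          (∑ L, mpow (matA t) j a L * mpow (matA t) j b L * mpow (matC t) j c' L) =
            kpow (strT t) j a b c' := by
        intro a b c'
        rw [orbit_mpow]
        congr 1
        funext i i' k
        exact (strT_eq_orbit ht i i' k).symm
      simp only [horbit, card_format] at hb
      push_cast at hb
      exact hb
    -- pass to the limit `t → 0`
    have hf : Continuous fun t : ℝ =>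
        ‖∑ a, ∑ b, ∑ c', kpow (strT t) j a b c' * kpow str j a b c'‖ ^ 2 :=
      ((continuous_finsetSum _ fun a _ => continuous_finsetSum _ fun b _ =>
        continuous_finsetSum _ fun c' _ => (continuous_kpow_strT j a b c').mul continuous_const).norm).pow 2
    have hg : Continuous fun t : ℝ =>
        c * ((4 : ℝ) ^ j) ^ ((3 : ℝ) / 2 - δ) * ∑ a, ∑ b, ∑ c', ‖kpow (strT t) j a b c'‖ ^ 2 :=
      continuous_const.mul (continuous_finsetSum _ fun a _ => continuous_finsetSum _ fun b _ =>
        continuous_finsetSum _ fun c' _ => ((continuous_kpow_strT j a b c').norm).pow 2)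
    have hev : ∀ᶠ t in 𝓝[≠] (0 : ℝ),
        ‖∑ a, ∑ b, ∑ c', kpow (strT t) j a b c' * kpow str j a b c'‖ ^ 2 ≤
          c * ((4 : ℝ) ^ j) ^ ((3 : ℝ) / 2 - δ) * ∑ a, ∑ b, ∑ c', ‖kpow (strT t) j a b c'‖ ^ 2 :=
      eventually_nhdsWithin_of_forall fun t ht => horb t ht
    have hlim := le_of_tendsto_of_tendsto ((hf.tendsto 0).mono_left nhdsWithin_le_nhds)
      ((hg.tendsto 0).mono_left nhdsWithin_le_nhds) hev
    simp only [strT_zero] at hlim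
    -- evaluate at `t = 0`: `(6^j)² ≤ c (4^j)^{3/2-δ} 6^j`
    rw [overlap_self_of_zeroOne hY01, Complex.norm_real, Real.norm_of_nonneg (by positivity), hnormSq,
      rpow_natPow_comm (by norm_num : (0 : ℝ) ≤ 4)] at hlim
    have h6 : (0 : ℝ) < 6 ^ j := by positivity
    rw [sq] at hlim
    exact le_of_mul_le_mul_right hlim h6
  -- Step 2: `6 ≤ 4^{3/2-δ}`, i.e. `logb 4 6 ≤ 3/2 - δ`
  have h46 : (6 : ℝ) ≤ (4 : ℝ) ^ ((3 : ℝ) / 2 - δ) :=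
    le_of_pow_le_mul_pow (Real.rpow_pos_of_pos (by norm_num) _) key
  have hlog : Real.logb 4 6 ≤ 3 / 2 - δ :=
    (Real.logb_le_iff_le_rpow (by norm_num) (by norm_num)).mpr h46
  linarith

/-- No witness of `stub_nonnegFlatDecay` has `δ > 3/2 − logb 4 6` (numerically `0.20752`). -/
theorem not_nonnegFlatDecay_of_lt {c δ : ℝ} (hδ : 3 / 2 - Real.logb 4 6 < δ) : ¬ NonnegFlatDecayBody c δ :=
  fun h => absurd (delta_le_of_body h) (not_le.mpr hδ)

/-- `logb 4 6 > 129/100`, i.e. `4^{129} < 6^{100}`. -/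
theorem logb_four_six_gt : (129 : ℝ) / 100 < Real.logb 4 6 := by
  rw [Real.lt_logb_iff_rpow_lt (by norm_num) (by norm_num)]
  have h1 : ((4 : ℝ) ^ ((129 : ℝ) / 100)) ^ (100 : ℕ) = (4 : ℝ) ^ (129 : ℕ) := by
    rw [← Real.rpow_natCast, ← Real.rpow_mul (by norm_num)]
    norm_num
  by_contra hcon
  push Not at hcon
  have h2 : (6 : ℝ) ^ (100 : ℕ) ≤ ((4 : ℝ) ^ ((129 : ℝ) / 100)) ^ (100 : ℕ) :=
    pow_le_pow_left₀ (by norm_num) hcon 100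
  rw [h1] at h2
  norm_num at h2

/-- **Rational form of the cap: every witness of `stub_nonnegFlatDecay` has `δ < 21/100`.** -/
theorem nonnegFlatDecay_delta_lt {c δ : ℝ} (h : NonnegFlatDecayBody c δ) : δ < 21 / 100 := by
  have h1 := delta_le_of_body h
  have h2 := logb_four_six_gt
  linarith


end NonnegFlatTightness

/-- **Registered sub-goal `flat_kron_nonneg`: the non-negative half of Zhu–Chen–Hayashi, def-free** — the Kronecker
product of an entrywise non-negative flat tensor with a flat tensor is flat (`NonnegFlatTightness.flat_kron`). -/
theorem flat_kron_nonneg :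
    ∀ (α β : Type) [Fintype α] [Fintype β] (Y₁ : α → α → α → ℂ) (Y₂ : β → β → β → ℂ), (∀ a b c, ∃ t : ℝ, 0 ≤ t ∧ Y₁ a b c = t) → (∀ w u v : α → ℂ, ‖∑ i, ∑ j, ∑ k, w i * u j * v k * Y₁ i j k‖ ≤ Real.sqrt (∑ i, ‖w i‖ ^ 2) * Real.sqrt (∑ j, ‖u j‖ ^ 2) * Real.sqrt (∑ k, ‖v k‖ ^ 2)) → (∀ w u v : β → ℂ, ‖∑ i, ∑ j, ∑ k, w i * u j * v k * Y₂ i j k‖ ≤ Real.sqrt (∑ i, ‖w i‖ ^ 2) * Real.sqrt (∑ j, ‖u j‖ ^ 2) * Real.sqrt (∑ k, ‖v k‖ ^ 2)) → ∀ w u v : α × β → ℂ, ‖∑ x, ∑ y, ∑ z, w x * u y * v z * (Y₁ x.1 y.1 z.1 * Y₂ x.2 y.2 z.2)‖ ≤ Real.sqrt (∑ x, ‖w x‖ ^ 2) * Real.sqrt (∑ y, ‖u y‖ ^ 2) * Real.sqrt (∑ z, ‖v z‖ ^ 2) :=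
  fun _ _ _ _ _ _ h₁ hf₁ hf₂ => NonnegFlatTightness.flat_kron h₁ hf₁ hf₂

/-- **Registered sub-goal `nonnegFlatDecay_delta_le`: TIGHTNESS OF THE OPEN STUB, def-free** — every witness `(c, δ)` of
`stub_nonnegFlatDecay` (its body verbatim as the hypothesis) has `δ ≤ 3/2 − logb 4 6 ≈ 0.2075`. -/
theorem nonnegFlatDecay_delta_le :
    ∀ c δ : ℝ, (∀ (ι : Type) [Fintype ι] [DecidableEq ι] (Y : ι → ι → ι → ℂ), (∀ i j k, ∃ t : ℝ, 0 ≤ t ∧ Y i j k = t) → (∀ w u v : ι → ℂ, ‖∑ i, ∑ j, ∑ k, w i * u j * v k * Y i j k‖ ≤ Real.sqrt (∑ i, ‖w i‖ ^ 2) * Real.sqrt (∑ j, ‖u j‖ ^ 2) * Real.sqrt (∑ k, ‖v k‖ ^ 2)) → ∀ (A B C : Matrix ι ι ℂ), IsUnit A.det → IsUnit B.det → IsUnit C.det → ‖∑ i, ∑ j, ∑ k, (∑ l, A i l * B j l * C k l) * Y i j k‖ ^ 2 ≤ c * (Fintype.card ι : ℝ) ^ ((3 : ℝ) / 2 - δ)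 * ∑ i, ∑ j, ∑ k, ‖∑ l, A i l * B j l * C k l‖ ^ 2) → δ ≤ 3 / 2 - Real.logb 4 6 :=
  fun _ _ h => NonnegFlatTightness.delta_le_of_body h

end Summit.MatrixMultiplication.MatrixMultiplication.Theorems.DiagonalPowerDecay

end
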